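import Summits.AtomisticToContinuum.FouriersLaw.Theorems.BondHeatUncertaintySubdiffusiveBondHeatJunctionRatioRootContactFrames

/-!
# `JunctionRatioRootTransferLadder` — file 20: the DEPTH-GROWTH DIAL of the root contact laws and its calibration (midpoint pinch)
# (cell `decomp-a2c`, lens-1 «grading / quantitative ladder», gen 63; beneath file 18b `…JunctionRatioRootContactFrames`; target 11071)

Files 18a/19a/19b type the root contact law [RT_d] (`|(T + δ/2) − ⟨p_d²⟩| ≤ δ·(C_d·√E_N + ε)` and mirror) and reduce `d = 1` to four attackable
pieces.  The LADDER QUESTION of this lens is how the constants `C_d` may grow with the depth `d`.  This file types the growth as a DIAL and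
CALIBRATES it by an elementary MIDPOINT PINCH:

* `DepthUniformRootThermalisationAt … θ C` — [RT_d] for ALL depths `d < N` simultaneously with constant `C·(d + 1)^θ` (`θ ≥ 0`); restriction
  `rootThermalisationAt_of_depthUniform : … → RootThermalisationAt … (C·(d+1)^θ) d`.  Global `DepthUniformRootThermalisation θ`.
* MIDPOINT PINCH (PROVED, `escapeFloor_of_depthUniform`): the hot clause at depth `m = ⌊N/2⌋` and the cold clause at depth `N − 1 − m` control the
  SAME site from both sides; adding them at `ε = ¼` against a steady state (`pinnedChain_exists_isSteadyState`) gives `1 ≤ 4C·N^θ·√E_N`, i.e. the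
  ESCAPE FLOOR `1/(16C²) ≤ (N^θ)²·E_N` eventually.
* CALIBRATION (PROVED): `θ = ½` ⟹ `ConductanceFloor` (`conductanceFloor_of_depthUniform_half`; the REP-type floor `c ≤ N·E_N`, open, believed);
  `θ = 0` ⟹ `¬EscapeInfZero` (`not_escapeInfZero_of_depthUniform_zero`; i.e. bounded-in-depth transfer constants would prove BALLISTIC transport,
  refuted in evidence by 9127/9121); `0 ≤ θ < ½` ⟹ `¬OhmicFloor` ⟹ `¬BoundedResponse` (`not_boundedResponse_of_depthUniform_lt_half`: a growth slower
  than `√depth` is INCOMPATIBLE WITH THE TARGET 11071 itself).  Fourier heuristics (`T_d ≈ T + δ/2 − δE_N − δd(1 − 2E_N)/(N − 1)`, `E_N ≍ κ/(γN)`) make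
  `θ = ½` TRUE-in-evidence with `C ≈ (κ/γ + 1)/√(κ/γ)`.  VERDICT FOR THE LADDER: the `√depth` growth of the transfer constants is exactly the Fourier
  signature; any bond-by-bond iteration of the first-bond transfer (file 19b) with depth-bounded constants is dead on arrival, and the depth-uniform
  law at `θ = ½` is a FLOOR-side statement (it yields `ConductanceFloor`, not 11071) — the door's `N → ∞` content stays in [PBL].
No `sorry`; standard axioms; imports only file 18b.
-/

noncomputable section

open MeasureTheory Filter Topology Set
open scoped BigOperators

namespace Summit.AtomisticToContinuum.FouriersLaw.Theorems.SubdiffusiveBondHeat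

namespace EscapeGrading

open Literature.MathematicalPhysics.KineticTheory.HeatConduction
open Summit.AtomisticToContinuum.FouriersLaw.Theses.BondHeatUncertainty (BoundedResponse NonBallistic)
open Summit.AtomisticToContinuum.FouriersLaw.Theorems.SubdiffusiveBondHeat.JunctionDefectGrading

/-! ## A. The dial -/

/-- **Depth-uniform root thermalisation with growth exponent `θ` and constant `C`:** `∃ N₂ ∀ N ≥ N₂ ∀ d < N`: the two [RT_d] clauses with constant
`C·(d + 1)^θ`.  DIAL · UNDECIDED; `θ = ½` TRUE-in-evidence, `θ < ½` incompatible with 11071, `θ = 0` incompatible with 9127 (§C). [piece · dial] -/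
def DepthUniformRootThermalisationAt (ω₂ lam β γ T θ C : ℝ) : Prop :=
  ∃ N₂ : ℕ, ∀ N : ℕ, N₂ ≤ N → ∀ d : ℕ, ∀ (_hd : d + 1 ≤ N), ∀ ε : ℝ, 0 < ε →
    ∃ δ₀ : ℝ, 0 < δ₀ ∧ ∀ δ : ℝ, 0 < δ → δ < δ₀ →
      ∀ μ : Measure (PhaseSpace N), (pinnedChain ω₂ lam β γ).IsSteadyState N (T + δ / 2) (T - δ / 2) μ →
        |(T + δ / 2) - ∫ x, x.2 ⟨d, by omega⟩ ^ 2 ∂μ| ≤ δ * (C * ((d : ℝ) + 1) ^ θ * Real.sqrt (escapeDeficit ω₂ lam β γ T N) + ε) ∧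
        |∫ x, x.2 ⟨N - 1 - d, by omega⟩ ^ 2 ∂μ - (T - δ / 2)| ≤ δ * (C * ((d : ℝ) + 1) ^ θ * Real.sqrt (escapeDeficit ω₂ lam β γ T N) + ε)

/-- Restriction of the dial to one depth: `RootThermalisationAt … (C·(d+1)^θ) d`. [folklore] -/
theorem rootThermalisationAt_of_depthUniform {ω₂ lam β γ T θ C : ℝ} (h : DepthUniformRootThermalisationAt ω₂ lam β γ T θ C) (d : ℕ) :
    RootThermalisationAt ω₂ lam β γ T (C * ((d : ℝ) + 1) ^ θ) d := by
  obtain ⟨N₂, hN₂⟩ := h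
  exact ⟨N₂, fun N hN hd ε hε => hN₂ N hN d hd ε hε⟩

/-- **[dial] global:** for all parameters and `T > 0` there is `C` with `DepthUniformRootThermalisationAt … θ C`. [piece · dial] -/
def DepthUniformRootThermalisation (θ : ℝ) : Prop :=
  ∀ ω₂ lam β γ : ℝ, 0 < ω₂ → 0 < lam → 0 < β → 0 < γ → ∀ T : ℝ, 0 < T → ∃ C : ℝ, DepthUniformRootThermalisationAt ω₂ lam β γ T θ C

/-- `DepthUniformRootThermalisation θ ⟹ RootThermalisation d` for every depth. [folklore] -/
theorem rootThermalisation_of_depthUniform {θ : ℝ} (h : DepthUniformRootThermalisation θ) (d : ℕ) : RootThermalisation d :=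
  fun ω₂ lam β γ hω hl hβ hγ T hT => by
    obtain ⟨C, hC⟩ := h ω₂ lam β γ hω hl hβ hγ T hT
    exact ⟨_, rootThermalisationAt_of_depthUniform hC d⟩

/-! ## B. The midpoint pinch: dial ⟹ escape floor `1/(16C²) ≤ (N^θ)²·E_N` -/

/-- Elementary pinch: two one-sided bounds on the same quantity from `T ± δ/2` force `1 ≤ K₁ + K₂ + 2ε`. [folklore] -/
theorem one_le_of_pinch {T δ X K₁ K₂ ε : ℝ} (hδ : 0 < δ) (h₁ : (T + δ / 2) - X ≤ δ * (K₁ + ε)) (h₂ : X - (T - δ / 2) ≤ δ * (K₂ + ε)) :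
    1 ≤ K₁ + K₂ + 2 * ε := by
  by_contra h
  rw [not_le] at h
  nlinarith

/-- **The pinch inequality:** under the dial (`θ ≥ 0`), `1 ≤ 4C·N^θ·√E_N` for `N ≥ max N₂ 2`. [this file · the computation] -/
theorem one_le_of_depthUniform {ω₂ lam β γ T θ C : ℝ} (hω : 0 < ω₂) (hl : 0 < lam) (hβ : 0 < β) (hγ : 0 < γ) (hT : 0 < T)
    (hθ : 0 ≤ θ) {N₂ : ℕ}
    (hN₂ : ∀ N : ℕ, N₂ ≤ N → ∀ d : ℕ, ∀ (_hd : d + 1 ≤ N), ∀ ε : ℝ, 0 < ε →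
      ∃ δ₀ : ℝ, 0 < δ₀ ∧ ∀ δ : ℝ, 0 < δ → δ < δ₀ →
        ∀ μ : Measure (PhaseSpace N), (pinnedChain ω₂ lam β γ).IsSteadyState N (T + δ / 2) (T - δ / 2) μ →
          |(T + δ / 2) - ∫ x, x.2 ⟨d, by omega⟩ ^ 2 ∂μ| ≤ δ * (C * ((d : ℝ) + 1) ^ θ * Real.sqrt (escapeDeficit ω₂ lam β γ T N) + ε) ∧
          |∫ x, x.2 ⟨N - 1 - d, by omega⟩ ^ 2 ∂μ - (T - δ / 2)| ≤ δ * (C * ((d : ℝ) + 1) ^ θ * Real.sqrt (escapeDeficit ω₂ lam β γ T N) + ε))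
    {N : ℕ} (hN : max N₂ 2 ≤ N) :
    1 ≤ 4 * C * (N : ℝ) ^ θ * Real.sqrt (escapeDeficit ω₂ lam β γ T N) := by
  have hN₂N : N₂ ≤ N := le_trans (le_max_left _ _) hN
  have hN2 : 2 ≤ N := le_trans (le_max_right _ _) hN
  obtain ⟨δ₁, hδ₁, H₁⟩ := hN₂ N hN₂N (N / 2) (by omega) (1 / 4) (by norm_num)
  obtain ⟨δ₂, hδ₂, H₂⟩ := hN₂ N hN₂N (N - 1 - N / 2) (by omega) (1 / 4) (by norm_num)
  set δ : ℝ := min (min δ₁ δ₂) T / 2 with hδdef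
  have hmin : 0 < min (min δ₁ δ₂) T := lt_min (lt_min hδ₁ hδ₂) hT
  have hδ : 0 < δ := by rw [hδdef]; linarith
  have hδ₁' : δ < δ₁ := by
    have : min (min δ₁ δ₂) T ≤ δ₁ := (min_le_left _ _).trans (min_le_left _ _)
    rw [hδdef]; linarith
  have hδ₂' : δ < δ₂ := by
    have : min (min δ₁ δ₂) T ≤ δ₂ := (min_le_left _ _).trans (min_le_right _ _)
    rw [hδdef]; linarith
  have hδT : δ ≤ T / 2 := by
    have : min (min δ₁ δ₂) T ≤ T := min_le_right _ _
    rw [hδdef]; linarith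
  have hTL : 0 < T + δ / 2 := by linarith
  have hTR : 0 < T - δ / 2 := by linarith
  obtain ⟨μ, hμ⟩ := pinnedChain_exists_isSteadyState hω hl hβ hγ N hTL hTR
  have A := (abs_le.1 (H₁ δ hδ hδ₁' μ hμ).1).2
  have B := (abs_le.1 (H₂ δ hδ hδ₂' μ hμ).2).2
  have hidx : N - 1 - (N - 1 - N / 2) = N / 2 := by omega
  simp only [hidx] at B
  set S := Real.sqrt (escapeDeficit ω₂ lam β γ T N) with hS
  have hS0 : 0 ≤ S := Real.sqrt_nonneg _
  have P := one_le_of_pinch hδ A B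
  -- the two depth factors are at most `N^θ`
  have hNpos : (0 : ℝ) < N := by exact_mod_cast (show 0 < N by omega)
  have f₁ : ((N / 2 : ℕ) : ℝ) + 1 ≤ N := by exact_mod_cast (show N / 2 + 1 ≤ N by omega)
  have f₂ : ((N - 1 - N / 2 : ℕ) : ℝ) + 1 ≤ N := by exact_mod_cast (show N - 1 - N / 2 + 1 ≤ N by omega)
  have g₁ : (((N / 2 : ℕ) : ℝ) + 1) ^ θ ≤ (N : ℝ) ^ θ := Real.rpow_le_rpow (by positivity) f₁ hθ
  have g₂ : (((N - 1 - N / 2 : ℕ) : ℝ) + 1) ^ θ ≤ (N : ℝ) ^ θ := Real.rpow_le_rpow (by positivity) f₂ hθ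
  have g₁0 : 0 ≤ (((N / 2 : ℕ) : ℝ) + 1) ^ θ := by positivity
  have g₂0 : 0 ≤ (((N - 1 - N / 2 : ℕ) : ℝ) + 1) ^ θ := by positivity
  rcases le_or_gt C 0 with hC | hC
  · -- `C ≤ 0`: both transfer terms are `≤ 0`, so the pinch gives `1 ≤ 1/2`
    have t₁ : C * ((((N / 2 : ℕ) : ℝ) + 1) ^ θ) * S ≤ 0 :=
      mul_nonpos_of_nonpos_of_nonneg (mul_nonpos_of_nonpos_of_nonneg hC g₁0) hS0
    have t₂ : C * ((((N - 1 - N / 2 : ℕ) : ℝ) + 1) ^ θ) * S ≤ 0 :=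
      mul_nonpos_of_nonpos_of_nonneg (mul_nonpos_of_nonpos_of_nonneg hC g₂0) hS0
    linarith
  · have t₁ : C * ((((N / 2 : ℕ) : ℝ) + 1) ^ θ) * S ≤ C * (N : ℝ) ^ θ * S :=
      mul_le_mul_of_nonneg_right (mul_le_mul_of_nonneg_left g₁ hC.le) hS0
    have t₂ : C * ((((N - 1 - N / 2 : ℕ) : ℝ) + 1) ^ θ) * S ≤ C * (N : ℝ) ^ θ * S :=
      mul_le_mul_of_nonneg_right (mul_le_mul_of_nonneg_left g₂ hC.le) hS0
    linarith

/-- **Dial ⟹ escape floor:** `∃ c > 0 ∃ N₂ ∀ N ≥ N₂`, `c ≤ (N^θ)²·E_N` (`c = 1/(16C²)`). [this file · composition] -/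
theorem escapeFloor_of_depthUniform {ω₂ lam β γ T θ C : ℝ} (hω : 0 < ω₂) (hl : 0 < lam) (hβ : 0 < β) (hγ : 0 < γ) (hT : 0 < T)
    (hθ : 0 ≤ θ) (h : DepthUniformRootThermalisationAt ω₂ lam β γ T θ C) :
    ∃ c : ℝ, 0 < c ∧ ∃ N₂ : ℕ, ∀ N : ℕ, N₂ ≤ N → c ≤ ((N : ℝ) ^ θ) ^ 2 * escapeDeficit ω₂ lam β γ T N := by
  obtain ⟨N₂, hN₂⟩ := h
  have pinch : ∀ N : ℕ, max N₂ 2 ≤ N → 1 ≤ 4 * C * (N : ℝ) ^ θ * Real.sqrt (escapeDeficit ω₂ lam β γ T N) :=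
    fun N hN => one_le_of_depthUniform hω hl hβ hγ hT hθ hN₂ hN
  rcases le_or_gt C 0 with hC | hC
  · exfalso
    have P := pinch (max N₂ 2) le_rfl
    have : 4 * C * ((max N₂ 2 : ℕ) : ℝ) ^ θ * Real.sqrt (escapeDeficit ω₂ lam β γ T (max N₂ 2)) ≤ 0 :=
      mul_nonpos_of_nonpos_of_nonneg (mul_nonpos_of_nonpos_of_nonneg (by linarith) (by positivity)) (Real.sqrt_nonneg _)
    linarith
  · refine ⟨1 / (16 * C ^ 2), by positivity, max N₂ 2, fun N hN => ?_⟩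
    have hE0 : 0 ≤ escapeDeficit ω₂ lam β γ T N := escapeDeficit_nonneg' hω hl hβ hγ hT (le_trans (le_max_right _ _) hN)
    have P := pinch N hN
    have P2 : 1 ≤ (4 * C * (N : ℝ) ^ θ * Real.sqrt (escapeDeficit ω₂ lam β γ T N)) ^ 2 := by nlinarith
    have e : (4 * C * (N : ℝ) ^ θ * Real.sqrt (escapeDeficit ω₂ lam β γ T N)) ^ 2
        = 16 * C ^ 2 * (((N : ℝ) ^ θ) ^ 2 * escapeDeficit ω₂ lam β γ T N) := by
      rw [show (4 * C * (N : ℝ) ^ θ * Real.sqrt (escapeDeficit ω₂ lam β γ T N)) ^ 2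
          = 16 * C ^ 2 * (((N : ℝ) ^ θ) ^ 2 * (Real.sqrt (escapeDeficit ω₂ lam β γ T N)) ^ 2) by ring, Real.sq_sqrt hE0]
    rw [e] at P2
    rw [div_le_iff₀ (by positivity)]
    linarith

/-! ## C. Calibration of the dial -/

/-- From an eventual positive floor to a floor for all `N ≥ 2`, given positivity term by term. [folklore] -/
theorem floor_all_of_eventually (f : ℕ → ℝ) (hpos : ∀ N : ℕ, 2 ≤ N → 0 < f N) :
    ∀ N₂ : ℕ, ∀ c : ℝ, 0 < c → (∀ N : ℕ, N₂ ≤ N → 2 ≤ N → c ≤ f N) → ∃ c' : ℝ, 0 < c' ∧ ∀ N : ℕ, 2 ≤ N → c' ≤ f N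
  | 0, c, hc, h => ⟨c, hc, fun N hN => h N (Nat.zero_le _) hN⟩
  | (K + 1), c, hc, h =>
      floor_all_of_eventually f hpos K (min c (f (max K 2))) (lt_min hc (hpos _ (le_max_right _ _))) fun N hKN h2N => by
        rcases Nat.eq_or_lt_of_le hKN with rfl | hlt
        · rw [max_eq_left h2N]; exact min_le_right _ _
        · exact (min_le_left _ _).trans (h N hlt h2N)

/-- **`θ = ½` ⟹ `ConductanceFloor`** (the REP-type floor `0 < c ≤ N·E_N`, `N ≥ 2`). [this file · calibration] -/
theorem conductanceFloor_of_depthUniform_half (h : DepthUniformRootThermalisation (1 / 2)) : ConductanceFloor := by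
  intro ω₂ lam β γ hω hl hβ hγ T hT
  obtain ⟨C, hC⟩ := h ω₂ lam β γ hω hl hβ hγ T hT
  obtain ⟨c, hc, N₂, hN₂⟩ := escapeFloor_of_depthUniform hω hl hβ hγ hT (by norm_num) hC
  refine floor_all_of_eventually (fun N => (N : ℝ) * escapeDeficit ω₂ lam β γ T N)
    (fun N hN => mul_pos (by exact_mod_cast (show 0 < N by omega)) (escapeDeficit_pos hω hl hβ hγ hT hN)) N₂ c hc fun N hN _ => ?_
  have e : ((N : ℝ) ^ (1 / 2 : ℝ)) ^ 2 = N := by rw [← Real.sqrt_eq_rpow, Real.sq_sqrt (Nat.cast_nonneg N)]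
  have := hN₂ N hN
  rw [e] at this
  exact this

/-- **`θ = 0` ⟹ `¬EscapeInfZero`**: depth-bounded transfer constants would give `E_N ≥ c > 0` eventually — BALLISTIC transport, refuted in
evidence by 9127 (`EscapeInfZero ⟺ NonBallistic`). [this file · calibration] -/
theorem not_escapeInfZero_of_depthUniform_zero (h : DepthUniformRootThermalisation 0) : ¬ EscapeInfZero := by
  intro hI
  obtain ⟨C, hC⟩ := h 1 1 1 1 one_pos one_pos one_pos one_pos 1 one_pos
  obtain ⟨c, hc, N₂, hN₂⟩ := escapeFloor_of_depthUniform one_pos one_pos one_pos one_pos one_pos le_rfl hC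
  obtain ⟨N, hN, hE⟩ := hI 1 1 1 1 one_pos one_pos one_pos one_pos 1 one_pos (c / 2) (by positivity) N₂
  have := hN₂ N hN
  simp only [Real.rpow_zero, one_pow, one_mul] at this
  linarith

/-- **`0 ≤ θ < ½` ⟹ `¬OhmicFloor`**: `c ≤ N^{2θ}·E_N ≤ C₁·N^{2θ−1} → 0`.  A transfer-constant growth slower than `√depth` is incompatible
with the target. [this file · calibration] -/
theorem not_ohmicFloor_of_depthUniform_lt_half {θ : ℝ} (hθ0 : 0 ≤ θ) (hθ : θ < 1 / 2) (h : DepthUniformRootThermalisation θ) :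
    ¬ OhmicFloor := by
  intro hO
  obtain ⟨C, hC⟩ := h 1 1 1 1 one_pos one_pos one_pos one_pos 1 one_pos
  obtain ⟨c, hc, N₂, hN₂⟩ := escapeFloor_of_depthUniform one_pos one_pos one_pos one_pos one_pos hθ0 hC
  obtain ⟨C₁, N₀, hN₀⟩ := hO 1 1 1 1 one_pos one_pos one_pos one_pos 1 one_pos
  -- `C₁ · x^{-(1-2θ)} → 0` along the naturals
  have hy : 0 < 1 - 2 * θ := by linarith
  have lim : Tendsto (fun N : ℕ => C₁ * ((N : ℝ) ^ (-(1 - 2 * θ)))) atTop (𝓝 (C₁ * 0)) :=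
    ((tendsto_rpow_neg_atTop hy).comp tendsto_natCast_atTop_atTop).const_mul C₁
  rw [mul_zero] at lim
  obtain ⟨N₁, hN₁⟩ := eventually_atTop.1 ((tendsto_order.1 lim).2 c hc)
  set N := max (max N₁ N₂) (max N₀ 1) with hNdef
  have h₁ : N₁ ≤ N := (le_max_left _ _).trans (le_max_left _ _)
  have h₂ : N₂ ≤ N := (le_max_right _ _).trans (le_max_left _ _)
  have h₀ : N₀ ≤ N := (le_max_left _ _).trans (le_max_right _ _)
  have hN1 : 1 ≤ N := (le_max_right _ _).trans (le_max_right _ _)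
  have hNpos : (0 : ℝ) < N := by exact_mod_cast (show 0 < N by omega)
  have lo := hN₂ N h₂
  have up : ((N : ℝ) ^ θ) ^ 2 * escapeDeficit 1 1 1 1 1 N ≤ ((N : ℝ) ^ θ) ^ 2 * (C₁ / N) :=
    mul_le_mul_of_nonneg_left (hN₀ N h₀) (by positivity)
  have e : ((N : ℝ) ^ θ) ^ 2 * (C₁ / N) = C₁ * (N : ℝ) ^ (-(1 - 2 * θ)) := by
    have e1 : ((N : ℝ) ^ θ) ^ 2 = (N : ℝ) ^ (2 * θ) := by
      rw [← Real.rpow_natCast, ← Real.rpow_mul hNpos.le]; norm_num; ring_nf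
    rw [e1, show -(1 - 2 * θ) = 2 * θ - 1 by ring, Real.rpow_sub_one hNpos.ne' (2 * θ)]
    ring
  have small := hN₁ N h₁
  rw [← e] at small
  linarith

/-- **`0 ≤ θ < ½` ⟹ `¬BoundedResponse`** (11071 refutes every sub-`√depth` growth of the transfer constants). [this file · calibration] -/
theorem not_boundedResponse_of_depthUniform_lt_half {θ : ℝ} (hθ0 : 0 ≤ θ) (hθ : θ < 1 / 2) (h : DepthUniformRootThermalisation θ) :
    ¬ BoundedResponse :=
  fun hB => not_ohmicFloor_of_depthUniform_lt_half hθ0 hθ h (ohmicFloor_iff_boundedResponse.2 hB)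

end EscapeGrading

end Summit.AtomisticToContinuum.FouriersLaw.Theorems.SubdiffusiveBondHeat

end
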